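import Mathlib.Topology.Homotopy.Lifting
import Mathlib.Topology.Homotopy.Product
import HarnessLib

/-!
# Monodromy in a family of coverings: the fibres of a covering of `B × U` over a path in `U`

Topic `Literature/Topology/CoveringSpaces`.  Let `p : E → B × U` be a covering map and `c` a path
in the parameter space `U` from `u` to `u'`.  Restricting `p` over `B × {u}` and `B × {u'}` gives two
coverings `E_u → B`, `E_{u'} → B` (`E_u = {e | (p e)₂ = u}`); this file proves, in the language of
Mathlib's covering-space theory (`IsCoveringMap.monodromy`, J. Xu: transport of fibres along
homotopy classes of paths; `IsCoveringMap.liftPath` and the uniqueness of lifts), that these two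
coverings have THE SAME MONODROMY:

* `monodromy_prod_refl_monodromy_refl_prod`, `monodromy_refl_prod_monodromy_prod_refl`,
  `monodromy_prod_refl_transport` — the transport `τ_c` of the fibre over `(b, u)` to the fibre over
  `(b', u')` along `(b, c)` intertwines the monodromies along `(γ, u)` and `(γ, u')`, for every path
  class `γ` from `b` to `b'` in `B`: both composites are the monodromy along `(γ, c)` (the two
  boundary routes of the square `γ × c` are homotopic; Mathlib `Path.Homotopic.comp_prod_eq_prod_comp`);
* `monodromy_prod_refl_transport_eq_iff` — hence a loop class `γ` at `b` fixes `e` over `(b, u)` iff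
  it fixes `τ_c e` over `(b, u')` (`τ_c` is a bijection, `IsCoveringMap.monodromy_bijective`);
* `monodromy_mk_eq_iff` — monodromy along `⟦γ⟧` sends `e` to `e'` iff `γ` lifts to a path from `e`
  to `e'` (path lifting and its uniqueness);
* `exists_loop_snd_eq_of_loop_snd_eq` — **loops specialise**: a loop in `E` at `e₀` lying in the
  fibre `E_u` yields a loop at `τ_c e₀` lying in `E_{u'}` with the same projection to `B`;
* `exists_path_comp_eq_of_snd_eq`, `exists_loop_of_loop_comp` — paths / loops in a fibre `E_u`
  starting at a point `ψ z` come from paths / loops in ANY covering `r : Z → B` mapping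
  continuously (and, for loops, injectively) into `E_u` over `B` (uniqueness of lifts);
* `isPathConnected_setOf_snd_eq` — **connectedness specialises**: `E_u` path connected ⇒ `E_{u'}`
  path connected;
* `pathConnectedSpace_of_injective_of_isPathConnected` — a covering `r : Z → B` of a non-empty
  space `Z` mapping continuously and injectively into a path connected fibre `E_u` over `B` is path
  connected.

This is the topological skeleton of the specialisation of the fundamental group in a locally
constant family (here: a covering of a product): for `U` path connected the isomorphism class of
the covering `E_u → B`, i.e. the conjugacy class of its monodromy, does not depend on `u`
(Hatcher, *Algebraic Topology*, §1.3: Prop. 1.30 (homotopy lifting), Prop. 1.31, Prop. 1.34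
(unique lifting) and the classification Thm. 1.38; tom Dieck, *Algebraic Topology*, §3.2 and
Thm. 3.3.2 (fibre transport is a functor on the fundamental groupoid)).  Everything is a theorem
about Mathlib notions; no definition, no named fact.  Consumer: descent of finite étale covers
from `ℂ` to `ℚ̄` by spreading out and specialisation (`Literature/AlgebraicGeometry/FundamentalGroup`).

## References

* A. Hatcher, *Algebraic Topology*, CUP 2002, §1.3 Prop. 1.30 (p. 60), Prop. 1.31 (p. 61),
  Prop. 1.34 (p. 62), Thm. 1.38 (p. 67). [HatcherAT2002]
* T. tom Dieck, *Algebraic Topology*, EMS 2008, §3.2 (fibre transport), Thm. 3.3.2.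
-/

noncomputable section

open Set unitInterval Function
open _root_.Topology

namespace Literature.Topology.CoveringSpaces

universe u v w

/-! ### Monodromy and lifted paths (any covering) -/

section General

variable {E : Type u} {X : Type v} [TopologicalSpace E] [TopologicalSpace X] {p : E → X}

/-- Monodromy along the class of a path `γ` sends `e` to the endpoint of the lift of `γ` at `e`
(Mathlib's definition, by `rfl`). [folklore] -/
theorem coe_monodromy_mk (hp : IsCoveringMap p) {x y : X} (γ : Path x y) (e : p ⁻¹' {x}) :
    (hp.monodromy ⟦γ⟧ e : E) = hp.liftPath γ e (γ.source.trans e.2.symm) 1 :=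
  rfl

/-- **Monodromy along `⟦γ⟧` sends `e` to `e'` iff `γ` lifts to a path from `e` to `e'`** (existence
and uniqueness of lifted paths, Hatcher Prop. 1.30). [cite: HatcherAT2002, §1.3 Prop. 1.30 (p. 60)] -/
theorem monodromy_mk_eq_iff (hp : IsCoveringMap p) {x y : X} (γ : Path x y) (e : p ⁻¹' {x})
    (e' : p ⁻¹' {y}) :
    hp.monodromy ⟦γ⟧ e = e' ↔ ∃ δ : Path (e : E) (e' : E), ∀ s, p (δ s) = γ s := by
  constructor
  · rintro rfl
    exact ⟨⟨hp.liftPath γ e (γ.source.trans e.2.symm), hp.liftPath_zero .., rfl⟩,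
      fun s ↦ congr_fun (hp.liftPath_lifts γ e (γ.source.trans e.2.symm)) s⟩
  · rintro ⟨δ, hδ⟩
    apply Subtype.ext
    have h : (δ : C(I, E)) = hp.liftPath γ e (γ.source.trans e.2.symm) :=
      (hp.eq_liftPath_iff' _).mpr ⟨funext hδ, δ.source⟩
    rw [coe_monodromy_mk, ← h]
    exact δ.target

/-- A loop `δ` at `e` whose projection is `γ` forces the monodromy of `⟦γ⟧` to fix `e`. [folklore] -/
theorem monodromy_mk_eq_self_of_loop (hp : IsCoveringMap p) {x : X} (γ : Path x x) (e : p ⁻¹' {x})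
    (δ : Path (e : E) (e : E)) (hδ : ∀ s, p (δ s) = γ s) : hp.monodromy ⟦γ⟧ e = e :=
  (monodromy_mk_eq_iff hp γ e e).mpr ⟨δ, hδ⟩

/-- Monodromy along `γ` and then along `γ.symm` is the identity. [folklore] -/
theorem monodromy_symm_monodromy (hp : IsCoveringMap p) {x y : X} (γ : Path.Homotopic.Quotient x y)
    (e : p ⁻¹' {x}) : hp.monodromy γ.symm (hp.monodromy γ e) = e := by
  rw [← hp.monodromy_trans_apply, Path.Homotopic.Quotient.trans_symm, hp.monodromy_refl, id]

/-- Monodromy along `γ.symm` and then along `γ` is the identity. [folklore] -/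
theorem monodromy_monodromy_symm (hp : IsCoveringMap p) {x y : X} (γ : Path.Homotopic.Quotient x y)
    (e : p ⁻¹' {y}) : hp.monodromy γ (hp.monodromy γ.symm e) = e := by
  rw [← hp.monodromy_trans_apply, Path.Homotopic.Quotient.symm_trans, hp.monodromy_refl, id]

end General

/-! ### Coverings of a product: transport along the parameter commutes with monodromy -/

section Product

variable {E : Type u} {B : Type v} {U : Type w} [TopologicalSpace E] [TopologicalSpace B]
  [TopologicalSpace U] {p : E → B × U}

/-- The path `(b, c)` reversed is the path `(b, c⁻¹)` (pointwise). [folklore] -/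
theorem refl_prod_symm (b : B) {u u' : U} (c : Path u u') :
    ((Path.refl b).prod c).symm = (Path.refl b).prod c.symm := by
  ext t <;> rfl

/-- On classes: `⟦(b, c⁻¹)⟧ = ⟦(b, c)⟧⁻¹`. [folklore] -/
theorem mk_refl_prod_symm (b : B) {u u' : U} (c : Path u u') :
    (⟦(Path.refl b).prod c.symm⟧ : Path.Homotopic.Quotient (b, u') (b, u)) =
      Path.Homotopic.Quotient.symm ⟦(Path.refl b).prod c⟧ := by
  rw [← refl_prod_symm]
  rfl

/-- **Transport along the parameter commutes with monodromy, I.** For a covering `p : E → B × U`,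
a path class `γ` from `b` to `b'` in `B` and `c` from `u` to `u'` in `U`: monodromy along `(b, c)`
followed by monodromy along `(γ, u')` is monodromy along `(γ, c)` — the route "up, then across"
of the square `γ × c`. [cite: HatcherAT2002, §1.3 Prop. 1.30 (p. 60)] -/
theorem monodromy_prod_refl_monodromy_refl_prod (hp : IsCoveringMap p) {b b' : B} {u u' : U}
    (γ : Path.Homotopic.Quotient b b') (c : Path.Homotopic.Quotient u u') (e : p ⁻¹' {(b, u)}) :
    hp.monodromy (Path.Homotopic.prod γ (.refl u')) (hp.monodromy (Path.Homotopic.prod (.refl b) c) e) =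
      hp.monodromy (Path.Homotopic.prod γ c) e := by
  rw [← hp.monodromy_trans_apply, Path.Homotopic.comp_prod_eq_prod_comp,
    Path.Homotopic.Quotient.refl_trans, Path.Homotopic.Quotient.trans_refl]

/-- **Transport along the parameter commutes with monodromy, II.** Monodromy along `(γ, u)`
followed by monodromy along `(b', c)` is monodromy along `(γ, c)` as well — the route "across, then
up". [cite: HatcherAT2002, §1.3 Prop. 1.30 (p. 60)] -/
theorem monodromy_refl_prod_monodromy_prod_refl (hp : IsCoveringMap p) {b b' : B} {u u' : U}
    (γ : Path.Homotopic.Quotient b b') (c : Path.Homotopic.Quotient u u') (e : p ⁻¹' {(b, u)}) :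
    hp.monodromy (Path.Homotopic.prod (.refl b') c) (hp.monodromy (Path.Homotopic.prod γ (.refl u)) e) =
      hp.monodromy (Path.Homotopic.prod γ c) e := by
  rw [← hp.monodromy_trans_apply, Path.Homotopic.comp_prod_eq_prod_comp,
    Path.Homotopic.Quotient.refl_trans, Path.Homotopic.Quotient.trans_refl]

/-- **The fibre transport `τ_c` along `(b, c)` is equivariant** for the monodromy actions of the
path classes of `B`: `τ_c (γ · e) = γ · τ_c e`, the action being along `(γ, u)` on the fibre over
`(b, u)` and along `(γ, u')` over `(b', u')` (tom Dieck, Thm. 3.3.2: transport is a functor on the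
fundamental groupoid of `B × U`, in which `(γ, u) · (b', c) = (b, c) · (γ, u')`).
[cite: HatcherAT2002, §1.3 Prop. 1.30 (p. 60)] -/
theorem monodromy_prod_refl_transport (hp : IsCoveringMap p) {b b' : B} {u u' : U}
    (γ : Path.Homotopic.Quotient b b') (c : Path.Homotopic.Quotient u u') (e : p ⁻¹' {(b, u)}) :
    hp.monodromy (Path.Homotopic.prod γ (.refl u')) (hp.monodromy (Path.Homotopic.prod (.refl b) c) e) =
      hp.monodromy (Path.Homotopic.prod (.refl b') c)
        (hp.monodromy (Path.Homotopic.prod γ (.refl u)) e) := by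
  rw [monodromy_prod_refl_monodromy_refl_prod, monodromy_refl_prod_monodromy_prod_refl]

/-- **A loop class `γ` at `b` fixes `e` over `(b, u)` iff it fixes the transported point `τ_c e`
over `(b, u')`**: the monodromy representations of the coverings `E_u → B` and `E_{u'} → B` are
isomorphic via the bijection `τ_c` (equivariance and `IsCoveringMap.monodromy_bijective`).
[cite: HatcherAT2002, §1.3 Prop. 1.30 and Thm. 1.38] -/
theorem monodromy_prod_refl_transport_eq_iff (hp : IsCoveringMap p) {b : B} {u u' : U}
    (γ : Path.Homotopic.Quotient b b) (c : Path.Homotopic.Quotient u u') (e : p ⁻¹' {(b, u)}) :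
    hp.monodromy (Path.Homotopic.prod γ (.refl u')) (hp.monodromy (Path.Homotopic.prod (.refl b) c) e) =
        hp.monodromy (Path.Homotopic.prod (.refl b) c) e ↔
      hp.monodromy (Path.Homotopic.prod γ (.refl u)) e = e := by
  rw [monodromy_prod_refl_transport]
  exact (hp.monodromy_bijective _).1.eq_iff

/-! ### Loops specialise along the parameter -/

/-- The projection to `B` of the covering map is continuous. [folklore] -/
theorem continuous_fst_comp (hp : IsCoveringMap p) : Continuous fun e ↦ (p e).1 :=
  continuous_fst.comp hp.continuous

/-- **Loops specialise.** Let `c` be a path from `u` to `u'` in `U`, `e₀ ∈ E` over `(b, u)`, and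
`e₁ = τ_c e₀` its transport along `(b, c)`.  Every loop `δ₀` at `e₀` inside the fibre `E_u` (second
coordinate of `p ∘ δ₀` constantly `u`) gives a loop `δ₁` at `e₁` inside `E_{u'}` with the same
projection to `B`: the class of `(p ∘ δ₀)₁` fixes `e₀` over `(b, u)`, hence fixes `e₁` over `(b, u')`
(`monodromy_prod_refl_transport_eq_iff`), i.e. `((p ∘ δ₀)₁, u')` lifts to a loop at `e₁`.
[cite: HatcherAT2002, §1.3 Prop. 1.30 (p. 60) and Prop. 1.31] -/
theorem exists_loop_snd_eq_of_loop_snd_eq (hp : IsCoveringMap p) {b : B} {u u' : U} (c : Path u u')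
    {e₀ e₁ : E} (he₀ : p e₀ = (b, u))
    (he₁ : (hp.monodromy ⟦(Path.refl b).prod c⟧ ⟨e₀, he₀⟩ : E) = e₁)
    (δ₀ : Path e₀ e₀) (hδ₀ : ∀ s, (p (δ₀ s)).2 = u) :
    ∃ δ₁ : Path e₁ e₁, ∀ s, p (δ₁ s) = ((p (δ₀ s)).1, u') := by
  -- the projection of `δ₀` to `B`, a loop at `b`
  let γ : Path b b :=
    { toFun := fun s ↦ (p (δ₀ s)).1
      continuous_toFun := (continuous_fst_comp hp).comp δ₀.continuous
      source' := by simp [he₀]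
      target' := by simp [he₀] }
  have hγ : ∀ s, p (δ₀ s) = (γ.prod (Path.refl u)) s := fun s ↦ Prod.ext rfl (hδ₀ s)
  -- `⟦(γ, u)⟧` fixes `e₀`, hence `⟦(γ, u')⟧` fixes `e₁`
  have h0 : hp.monodromy (Path.Homotopic.prod ⟦γ⟧ (.refl u)) ⟨e₀, he₀⟩ = ⟨e₀, he₀⟩ :=
    monodromy_mk_eq_self_of_loop hp (γ.prod (Path.refl u)) ⟨e₀, he₀⟩ δ₀ hγ
  have h1 := (monodromy_prod_refl_transport_eq_iff hp ⟦γ⟧ ⟦c⟧ ⟨e₀, he₀⟩).mpr h0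
  have he₁' : p e₁ = (b, u') := by
    have h := (hp.monodromy ⟦(Path.refl b).prod c⟧ ⟨e₀, he₀⟩).2
    rwa [mem_preimage, he₁, mem_singleton_iff] at h
  have hsub : hp.monodromy (Path.Homotopic.prod (.refl b) ⟦c⟧) ⟨e₀, he₀⟩ = ⟨e₁, he₁'⟩ :=
    Subtype.ext he₁
  rw [hsub] at h1
  obtain ⟨δ₁, hδ₁⟩ := (monodromy_mk_eq_iff hp (γ.prod (Path.refl u')) ⟨e₁, he₁'⟩ ⟨e₁, he₁'⟩).mp h1
  exact ⟨δ₁, fun s ↦ (hδ₁ s).trans rfl⟩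

/-- The transport back along `(b, c⁻¹)` followed by the transport along `(b, c)` is the identity:
`τ_c (τ_{c⁻¹} e₁) = e₁`. [folklore] -/
theorem monodromy_refl_prod_monodromy_refl_prod_symm (hp : IsCoveringMap p) {b : B} {u u' : U}
    (c : Path u u') (e₁ : p ⁻¹' {(b, u')}) :
    hp.monodromy ⟦(Path.refl b).prod c⟧ (hp.monodromy ⟦(Path.refl b).prod c.symm⟧ e₁) = e₁ := by
  rw [mk_refl_prod_symm]
  exact monodromy_monodromy_symm hp _ e₁

/-! ### Paths in a fibre come from any covering mapping into it -/

variable {Z : Type*} [TopologicalSpace Z] {r : Z → B}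

/-- **Lifting fibre paths through a comparison map.** Let `r : Z → B` be a covering map and
`ψ : Z → E` a continuous map into the fibre `E_u` over `r` (`p (ψ z) = (r z, u)`).  A path `α` in
`E` starting at `ψ z₁` and staying in `E_u` is `ψ ∘ Γ` for the lift `Γ` of its projection `(p ∘ α)₁`
through `r` at `z₁`: both are lifts through `p` of `((p ∘ α)₁, u)` from `ψ z₁` (uniqueness of lifts,
Hatcher Prop. 1.34). [cite: HatcherAT2002, §1.3 Prop. 1.30 and Prop. 1.34 (p. 62)] -/
theorem exists_path_comp_eq_of_snd_eq (hp : IsCoveringMap p) (hr : IsCoveringMap r) {u : U}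
    (ψ : Z → E) (hψc : Continuous ψ) (hψ : ∀ z, p (ψ z) = (r z, u)) (z₁ : Z) (α : C(I, E))
    (hα0 : α 0 = ψ z₁) (hα : ∀ s, (p (α s)).2 = u) :
    ∃ Γ : C(I, Z), Γ 0 = z₁ ∧ ψ ∘ Γ = α := by
  -- the projection of `α` to `B`
  let β : C(I, B) := ⟨fun s ↦ (p (α s)).1, (continuous_fst_comp hp).comp α.continuous⟩
  have hβ0 : β 0 = r z₁ := by
    change (p (α 0)).1 = r z₁
    rw [hα0, hψ]
  refine ⟨hr.liftPath β z₁ hβ0, hr.liftPath_zero .., ?_⟩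
  -- `ψ ∘ Γ` and `α` are two lifts of `(β, u)` from `ψ z₁`
  refine hp.eq_of_comp_eq (hψc.comp (hr.liftPath β z₁ hβ0).continuous) α.continuous ?_ 0 ?_
  · funext s
    rw [comp_apply, comp_apply, hψ, comp_apply]
    refine Prod.ext ?_ (hα s).symm
    exact congr_fun (hr.liftPath_lifts β z₁ hβ0) s
  · rw [comp_apply, hr.liftPath_zero, hα0]

/-- **Loops in a fibre come from loops upstairs.** With `r`, `ψ` as above and `ψ` moreover
injective, a loop in `E` at `ψ t` staying in `E_u` is the image of a loop in `Z` at `t` with the same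
projection to `B`. [cite: HatcherAT2002, §1.3 Prop. 1.31 and Prop. 1.34] -/
theorem exists_loop_of_loop_comp (hp : IsCoveringMap p) (hr : IsCoveringMap r) {u : U}
    (ψ : Z → E) (hψc : Continuous ψ) (hψi : Injective ψ) (hψ : ∀ z, p (ψ z) = (r z, u)) (t : Z)
    (δ : Path (ψ t) (ψ t)) (hδ : ∀ s, (p (δ s)).2 = u) :
    ∃ δ' : Path t t, ∀ s, r (δ' s) = (p (δ s)).1 := by
  obtain ⟨Γ, hΓ0, hΓ⟩ := exists_path_comp_eq_of_snd_eq hp hr ψ hψc hψ t δ δ.source hδ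
  have hΓ1 : Γ 1 = t := hψi (by rw [← comp_apply (f := ψ), hΓ]; exact δ.target)
  refine ⟨⟨Γ, hΓ0, hΓ1⟩, fun s ↦ ?_⟩
  have h := congr_arg (fun e ↦ (p e).1) (congr_fun hΓ s)
  simp only [comp_apply, hψ] at h
  exact h

/-- **A space covering `B` and injecting into a path connected fibre is path connected.** With
`r : Z → B` a covering and `ψ : Z → E_u` continuous, injective, over `r`: if the fibre
`E_u = {e | (p e)₂ = u}` is path connected and `Z` is non-empty then `Z` is path connected (join
`ψ z₁` to `ψ z₂` inside `E_u` and lift through `ψ` by `exists_path_comp_eq_of_snd_eq`).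
[cite: HatcherAT2002, §1.3 Prop. 1.30 and Prop. 1.34] -/
theorem pathConnectedSpace_of_injective_of_isPathConnected (hp : IsCoveringMap p)
    (hr : IsCoveringMap r) {u : U} (ψ : Z → E) (hψc : Continuous ψ) (hψi : Injective ψ)
    (hψ : ∀ z, p (ψ z) = (r z, u)) (hE : IsPathConnected {e | (p e).2 = u}) [Nonempty Z] :
    PathConnectedSpace Z := by
  refine ⟨‹Nonempty Z›, fun z₁ z₂ ↦ ?_⟩
  have h1 : ψ z₁ ∈ {e | (p e).2 = u} := by simp [hψ]
  have h2 : ψ z₂ ∈ {e | (p e).2 = u} := by simp [hψ]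
  have hj := hE.joinedIn _ h1 _ h2
  obtain ⟨Γ, hΓ0, hΓ⟩ := exists_path_comp_eq_of_snd_eq hp hr ψ hψc hψ z₁ hj.somePath
    hj.somePath.source hj.somePath_mem
  have hΓ1 : Γ 1 = z₂ := hψi (by rw [← comp_apply (f := ψ), hΓ]; exact hj.somePath.target)
  exact ⟨⟨Γ, hΓ0, hΓ1⟩⟩

/-! ### Connectedness specialises along the parameter -/

/-- **Path-connectedness of the fibres specialises.** If `c` is a path from `u` to `u'` in `U` and
the fibre `E_u` of the covering `p : E → B × U` over `u` is path connected, so is `E_{u'}`: transport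
a base point `x₀ ∈ E_u` to `y₀ = τ_c x₀ ∈ E_{u'}`; for `y ∈ E_{u'}` transport it back to
`x = τ_{c⁻¹} y ∈ E_u`, join `x₀` to `x` inside `E_u` by `α`, with projection `β` to `B`; then
`⟦(β, u')⟧ · y₀ = τ_c (⟦(β, u)⟧ · x₀) = τ_c x = y` by equivariance, so `(β, u')` lifts to a path from
`y₀` to `y` inside `E_{u'}`. [cite: HatcherAT2002, §1.3 Prop. 1.30 (p. 60) and Thm. 1.38] -/
theorem isPathConnected_setOf_snd_eq (hp : IsCoveringMap p) {u u' : U} (c : Path u u')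
    (hE : IsPathConnected {e | (p e).2 = u}) : IsPathConnected {e | (p e).2 = u'} := by
  obtain ⟨⟨x₀, hx₀⟩, hJ⟩ := (isPathConnected_iff (F := {e | (p e).2 = u})).mp hE
  have hpx₀ : p x₀ = ((p x₀).1, u) := Prod.ext rfl hx₀
  -- the transported base point
  set y₀' := hp.monodromy ⟦(Path.refl (p x₀).1).prod c⟧ ⟨x₀, hpx₀⟩ with hy₀'
  have hy₀ : p (y₀' : E) = ((p x₀).1, u') := y₀'.2
  refine (isPathConnected_iff (F := {e | (p e).2 = u'})).mpr ⟨⟨y₀', congr_arg Prod.snd hy₀⟩, ?_⟩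
  -- it suffices to join every `y ∈ E_{u'}` to `y₀` inside `E_{u'}`
  suffices H : ∀ y ∈ {e | (p e).2 = u'}, JoinedIn {e | (p e).2 = u'} (y₀' : E) y from
    fun x hx y hy ↦ (H x hx).symm.trans (H y hy)
  intro y hy
  have hpy : p y = ((p y).1, u') := Prod.ext rfl hy
  -- transport `y` back to `E_u` and join it to `x₀` there
  set x' := hp.monodromy ⟦(Path.refl (p y).1).prod c.symm⟧ ⟨y, hpy⟩ with hx'
  have hx : p (x' : E) = ((p y).1, u) := x'.2
  have hj := hJ x₀ hx₀ x' (congr_arg Prod.snd hx)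
  -- the projection `β` of the joining path
  let β : Path (p x₀).1 (p y).1 :=
    { toFun := fun s ↦ (p (hj.somePath s)).1
      continuous_toFun := (continuous_fst_comp hp).comp hj.somePath.continuous
      source' := by simp
      target' := by simp [hx] }
  have hβ : hp.monodromy (Path.Homotopic.prod ⟦β⟧ (.refl u)) ⟨x₀, hpx₀⟩ = x' :=
    (monodromy_mk_eq_iff hp (β.prod (Path.refl u)) ⟨x₀, hpx₀⟩ x').mpr
      ⟨hj.somePath, fun s ↦ Prod.ext rfl (hj.somePath_mem s)⟩
  -- equivariance: `⟦(β, u')⟧ · y₀ = τ_c (⟦(β, u)⟧ · x₀) = τ_c x = y`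
  have key : hp.monodromy (Path.Homotopic.prod ⟦β⟧ (.refl u')) y₀' = ⟨y, hpy⟩ := by
    rw [hy₀', show (⟦(Path.refl (p x₀).1).prod c⟧ : Path.Homotopic.Quotient _ _) =
        Path.Homotopic.prod (.refl (p x₀).1) ⟦c⟧ from rfl,
      monodromy_prod_refl_transport, hβ, hx']
    exact monodromy_refl_prod_monodromy_refl_prod_symm hp c ⟨y, hpy⟩
  obtain ⟨δ, hδ⟩ := (monodromy_mk_eq_iff hp (β.prod (Path.refl u')) y₀' ⟨y, hpy⟩).mp key
  exact ⟨δ, fun s ↦ by simpa using congr_arg Prod.snd (hδ s)⟩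

end Product

end Literature.Topology.CoveringSpaces

end
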